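import Literature.Analysis.FluidPDE.TaoClassGlue
import Literature.Analysis.FluidPDE.AxisymmetricEuler
import Literature.Analysis.FluidPDE.KNSSTypeIIProofs
import Literature.Analysis.FunctionSpaces.CkArzelaAscoli
import Mathlib.Analysis.SpecialFunctions.JapaneseBracket

/-! # Sequential compactness of a uniformly smooth, uniformly decaying axisymmetric family —
crux stmt-NavierStokesRegularity-0727 (`CertifiedBlowup.CertifiedBlowupAxisymBlowup`), line
`compact-amplification`, stub `stub_compact`

PROVED, exactly as registered: from a sequence of smooth, divergence-free, axisymmetric fields
`a n : ℝ³ → ℝ³` obeying one table of weighted bounds `(1 + ‖x‖) ^ K * ‖Dᵏ (a n) x‖ ≤ C k K`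
one extracts a subsequence `a ∘ φ` converging in `H¹` (as lower Lebesgue integrals of the squared
values and of the squared Fréchet derivatives of the differences) to a smooth, divergence-free,
axisymmetric limit `w` obeying the same table.

**Proof.** The `C^∞` Arzelà–Ascoli theorem of the tree
(`Literature.Analysis.FunctionSpaces.exists_strictMono_tendstoLocallyUniformlyOn_iteratedFDeriv_infty`,
with the uniform bounds `‖Dⁱ (a n)‖ ≤ C i 0`) gives a subsequence all of whose derivatives converge
locally uniformly, hence pointwise, to those of a smooth `w`. Pointwise limits keep the table
(`le_of_tendsto'`), the vanishing of the divergence (the trace of the Fréchet derivative is a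
continuous function of it) and the rotation equivariance (rotations are continuous,
`Literature.Analysis.FluidPDE.continuous_rotZ`). The `H¹`
convergence is dominated convergence: the differences and their gradients are bounded by
`2 C 0 2 (1 + ‖x‖)⁻²`, `2 C 1 2 (1 + ‖x‖)⁻²`, whose squares are integrable on `ℝ³`
(`finite_integral_one_add_norm`, exponent `4 > 3`).
-/

set_option linter.dupNamespace false

noncomputable section

open MeasureTheory Set Function Filter Topology
open scoped ENNReal NNReal ContDiff

namespace Summit.NavierStokesRegularity.NavierStokesRegularity.Theorems.CertifiedBlowupAxisymBlowup.CompactAmplification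

open Literature.Analysis.FluidPDE

local notation "ℝ³" => EuclideanSpace ℝ (Fin 3)

/-! ### Elementary helpers -/

/-- From a weighted bound `t² d ≤ c` with `t ≥ 1`, `d ≥ 0` to `d² ≤ c² (t⁴)⁻¹`. -/
theorem compact_sq_le_of_weighted {t d c : ℝ} (ht : 1 ≤ t) (hd : 0 ≤ d)
    (h : t ^ 2 * d ≤ c) : d ^ 2 ≤ c ^ 2 * (t ^ 4)⁻¹ := by
  have ht0 : 0 < t := by linarith
  rw [← div_eq_mul_inv, le_div_iff₀ (by positivity)]
  calc d ^ 2 * t ^ 4 = (t ^ 2 * d) ^ 2 := by ring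
    _ ≤ c ^ 2 := pow_le_pow_left₀ (by positivity) h 2

/-- Weighted bounds on two vectors give a weighted bound on their difference. -/
theorem compact_weighted_sub_le {G : Type*} [SeminormedAddCommGroup G] {t c : ℝ} {u v : G}
    (ht : 0 ≤ t) (hu : t * ‖u‖ ≤ c) (hv : t * ‖v‖ ≤ c) : t * ‖u - v‖ ≤ 2 * c := by
  calc t * ‖u - v‖ ≤ t * (‖u‖ + ‖v‖) := mul_le_mul_of_nonneg_left (norm_sub_le u v) ht
    _ = t * ‖u‖ + t * ‖v‖ := mul_add _ _ _
    _ ≤ c + c := add_le_add hu hv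
    _ = 2 * c := (two_mul c).symm

/-- If `v n → 0` in a normed group then `‖v n‖ₑ ^ 2 → 0`. -/
theorem compact_tendsto_enorm_sq {G : Type*} [NormedAddCommGroup G] {v : ℕ → G}
    (hv : Tendsto v atTop (𝓝 0)) : Tendsto (fun n => ‖v n‖ₑ ^ 2) atTop (𝓝 0) := by
  have hc : Continuous fun y : G => ‖y‖ₑ ^ 2 := (ENNReal.continuous_pow 2).comp continuous_enorm
  have h := (hc.tendsto 0).comp hv
  simpa only [Function.comp_def, enorm_zero, ne_eq, OfNat.ofNat_ne_zero, not_false_eq_true,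
    zero_pow] using h

/-- The dominating weight `c² (1 + ‖x‖)⁻⁴` has finite integral on `ℝ³` (exponent `4 > 3`). -/
theorem compact_lintegral_weight_ne_top (c : ℝ) :
    (∫⁻ x : ℝ³, ENNReal.ofReal (c ^ 2 * ((1 + ‖x‖) ^ 4)⁻¹)) ≠ ⊤ := by
  have h4 : ∀ x : ℝ³, ((1 + ‖x‖) ^ 4)⁻¹ = (1 + ‖x‖) ^ (-(4 : ℝ)) := fun x => by
    rw [Real.rpow_neg (by positivity), show (4 : ℝ) = ((4 : ℕ) : ℝ) by norm_num,
      Real.rpow_natCast]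
  simp_rw [ENNReal.ofReal_mul (sq_nonneg c), h4]
  rw [lintegral_const_mul' _ _ ENNReal.ofReal_ne_top]
  refine ENNReal.mul_ne_top ENNReal.ofReal_ne_top (finite_integral_one_add_norm ?_).ne
  rw [finrank_euclideanSpace_fin]
  norm_num

/-- **Dominated convergence in the form used twice.** Continuous fields `v n` on `ℝ³` with a
uniform weighted bound `(1 + ‖x‖)² ‖v n x‖ ≤ c` which tend to zero pointwise have
`∫⁻ ‖v n‖ₑ² → 0`. -/
theorem compact_lintegral_tendsto_zero {G : Type*} [NormedAddCommGroup G] {v : ℕ → ℝ³ → G}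
    {c : ℝ} (hcont : ∀ n, Continuous (v n)) (hb : ∀ n x, (1 + ‖x‖) ^ 2 * ‖v n x‖ ≤ c)
    (hlim : ∀ x, Tendsto (fun n => v n x) atTop (𝓝 0)) :
    Tendsto (fun n => ∫⁻ x, ‖v n x‖ₑ ^ 2) atTop (𝓝 0) := by
  have hmeas : ∀ n, Measurable fun x => ‖v n x‖ₑ ^ 2 := fun n =>
    ((ENNReal.continuous_pow 2).comp (hcont n).enorm).measurable
  have hdom : ∀ n, (fun x => ‖v n x‖ₑ ^ 2) ≤ᵐ[volume]
      fun x : ℝ³ => ENNReal.ofReal (c ^ 2 * ((1 + ‖x‖) ^ 4)⁻¹) := fun n =>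
    Eventually.of_forall fun x => by
      show ‖v n x‖ₑ ^ 2 ≤ ENNReal.ofReal (c ^ 2 * ((1 + ‖x‖) ^ 4)⁻¹)
      rw [← ofReal_norm, ← ENNReal.ofReal_pow (norm_nonneg _)]
      exact ENNReal.ofReal_le_ofReal (compact_sq_le_of_weighted
        (le_add_of_nonneg_right (norm_nonneg x)) (norm_nonneg _) (hb n x))
  have hptw : ∀ᵐ x : ℝ³ ∂volume,
      Tendsto (fun n => ‖v n x‖ₑ ^ 2) atTop (𝓝 ((fun _ : ℝ³ => (0 : ℝ≥0∞)) x)) :=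
    Eventually.of_forall fun x => compact_tendsto_enorm_sq (hlim x)
  have h := tendsto_lintegral_of_dominated_convergence _ hmeas hdom
    (compact_lintegral_weight_ne_top c) hptw
  simpa only [lintegral_zero] using h

/-! ### The extraction and the properties of the limit -/

/-- **`C^∞` Arzelà–Ascoli for the family**: a subsequence along which every derivative
converges pointwise to the corresponding derivative of a smooth limit. -/
theorem compact_extract {a : ℕ → ℝ³ → ℝ³} {C : ℕ → ℕ → ℝ} (hs : ∀ n, ContDiff ℝ ∞ (a n))
    (ht : ∀ n (k K : ℕ) (x : ℝ³), (1 + ‖x‖) ^ K * ‖iteratedFDeriv ℝ k (a n) x‖ ≤ C k K) :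
    ∃ (g : ℝ³ → ℝ³) (φ : ℕ → ℕ), StrictMono φ ∧ ContDiff ℝ ∞ g ∧
      ∀ (i : ℕ) (x : ℝ³), Tendsto (fun j => iteratedFDeriv ℝ i (a (φ j)) x) atTop
        (𝓝 (iteratedFDeriv ℝ i g x)) := by
  obtain ⟨g, φ, hφ, hg, hlim⟩ :=
    Literature.Analysis.FunctionSpaces.exists_strictMono_tendstoLocallyUniformlyOn_iteratedFDeriv_infty
      (f := a) isOpen_univ (fun j => (hs j).contDiffOn) (fun i => ⟨C i 0, fun j x _ => by
        simpa only [pow_zero, one_mul] using ht j i 0 x⟩)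
  exact ⟨g, φ, hφ, contDiffOn_univ.1 hg, fun i x => (hlim i).tendsto_at (mem_univ x)⟩

/-- Pointwise convergence of the values from that of the order-zero derivatives. -/
theorem compact_tendsto_apply {b : ℕ → ℝ³ → ℝ³} {g : ℝ³ → ℝ³}
    (hlim : ∀ (i : ℕ) (x : ℝ³), Tendsto (fun j => iteratedFDeriv ℝ i (b j) x) atTop
      (𝓝 (iteratedFDeriv ℝ i g x))) (x : ℝ³) :
    Tendsto (fun j => b j x) atTop (𝓝 (g x)) := by
  have h := ((continuous_eval_const (0 : Fin 0 → ℝ³)).tendsto _).comp (hlim 0 x)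
  simpa only [Function.comp_def, iteratedFDeriv_zero_apply] using h

/-- Pointwise convergence of the Fréchet derivatives from that of the order-one derivatives. -/
theorem compact_tendsto_fderiv {b : ℕ → ℝ³ → ℝ³} {g : ℝ³ → ℝ³}
    (hlim : ∀ (i : ℕ) (x : ℝ³), Tendsto (fun j => iteratedFDeriv ℝ i (b j) x) atTop
      (𝓝 (iteratedFDeriv ℝ i g x))) (x : ℝ³) :
    Tendsto (fun j => fderiv ℝ (b j) x) atTop (𝓝 (fderiv ℝ g x)) :=
  Literature.Analysis.FunctionSpaces.tendsto_fderiv_of_tendsto_iteratedFDeriv_one (w := b)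
    (hlim 1 x)

/-- The table of weighted bounds passes to the pointwise limit of the derivatives. -/
theorem compact_table_limit {b : ℕ → ℝ³ → ℝ³} {g : ℝ³ → ℝ³} {C : ℕ → ℕ → ℝ}
    (ht : ∀ n (k K : ℕ) (x : ℝ³), (1 + ‖x‖) ^ K * ‖iteratedFDeriv ℝ k (b n) x‖ ≤ C k K)
    (hlim : ∀ (i : ℕ) (x : ℝ³), Tendsto (fun j => iteratedFDeriv ℝ i (b j) x) atTop
      (𝓝 (iteratedFDeriv ℝ i g x))) (k K : ℕ) (x : ℝ³) :
    (1 + ‖x‖) ^ K * ‖iteratedFDeriv ℝ k g x‖ ≤ C k K :=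
  le_of_tendsto' (((hlim k x).norm).const_mul ((1 + ‖x‖) ^ K)) fun j => ht j k K x

/-- Incompressibility passes to the limit: the divergence is the trace of the Fréchet
derivative, a continuous function of it. -/
theorem compact_divFree_limit {b : ℕ → ℝ³ → ℝ³} {g : ℝ³ → ℝ³}
    (hdiv : ∀ n, VectorCalculus.IsDivFree (b n))
    (hD : ∀ x, Tendsto (fun j => fderiv ℝ (b j) x) atTop (𝓝 (fderiv ℝ g x))) :
    VectorCalculus.IsDivFree g := by
  intro x
  have ctr : Continuous fun L : ℝ³ →L[ℝ] ℝ³ => LinearMap.trace ℝ ℝ³ (L : ℝ³ →ₗ[ℝ] ℝ³) :=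
    ((LinearMap.trace ℝ ℝ³).comp (ContinuousLinearMap.coeLM ℝ)).continuous_of_finiteDimensional
  have h1 : Tendsto (fun j => VectorCalculus.divergence (b j) x) atTop
      (𝓝 (VectorCalculus.divergence g x)) := (ctr.tendsto _).comp (hD x)
  have h2 : (fun j => VectorCalculus.divergence (b j) x) = fun _ => (0 : ℝ) :=
    funext fun j => hdiv j x
  rw [h2] at h1
  exact tendsto_nhds_unique h1 tendsto_const_nhds

/-- Axisymmetry passes to the pointwise limit (rotations are continuous). -/
theorem compact_axisym_limit {b : ℕ → ℝ³ → ℝ³} {g : ℝ³ → ℝ³} (hax : ∀ n, IsAxisymmetric (b n))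
    (hv : ∀ x, Tendsto (fun j => b j x) atTop (𝓝 (g x))) : IsAxisymmetric g := by
  intro θ x
  have h1 : Tendsto (fun j => b j (rotZ θ x)) atTop (𝓝 (g (rotZ θ x))) := hv _
  have h2 : Tendsto (fun j => rotZ θ (b j x)) atTop (𝓝 (rotZ θ (g x))) :=
    ((continuous_rotZ θ).tendsto _).comp (hv x)
  have h3 : (fun j => b j (rotZ θ x)) = fun j => rotZ θ (b j x) := funext fun j => hax j θ x
  rw [h3] at h1
  exact tendsto_nhds_unique h1 h2

/-! ### The stub -/

/-- **Sequential compactness of the uniformly smooth, uniformly decaying axisymmetric family**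
(Arzelà–Ascoli for all derivatives + uniform polynomial tails; the limit keeps the constants,
smoothness, incompressibility and axisymmetry, and the convergence holds in `H¹`). -/
theorem stub_compact :
    ∀ (C : ℕ → ℕ → ℝ) (a : ℕ → ℝ³ → ℝ³),
      (∀ n, ContDiff ℝ ∞ (a n) ∧ VectorCalculus.IsDivFree (a n) ∧ IsAxisymmetric (a n) ∧
        ∀ (k K : ℕ) (x : ℝ³), (1 + ‖x‖) ^ K * ‖iteratedFDeriv ℝ k (a n) x‖ ≤ C k K) →
      ∃ (φ : ℕ → ℕ) (w : ℝ³ → ℝ³), StrictMono φ ∧ ContDiff ℝ ∞ w ∧ VectorCalculus.IsDivFree w ∧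
        IsAxisymmetric w ∧
        (∀ (k K : ℕ) (x : ℝ³), (1 + ‖x‖) ^ K * ‖iteratedFDeriv ℝ k w x‖ ≤ C k K) ∧
        ∀ ε : ℝ, 0 < ε → ∃ N : ℕ, ∀ n, N ≤ n →
          (∫⁻ x, ‖a (φ n) x - w x‖ₑ ^ 2) + (∫⁻ x, ‖fderiv ℝ (a (φ n)) x - fderiv ℝ w x‖ₑ ^ 2) ≤
            ENNReal.ofReal ε := by
  intro C a h
  obtain ⟨g, φ, hφ, hg, hlim⟩ := compact_extract (fun n => (h n).1) (fun n => (h n).2.2.2)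
  -- the extracted sequence `b j = a (φ j)`
  have hlim' : ∀ (i : ℕ) (x : ℝ³), Tendsto (fun j => iteratedFDeriv ℝ i ((fun j => a (φ j)) j) x)
      atTop (𝓝 (iteratedFDeriv ℝ i g x)) := hlim
  have htb : ∀ n (k K : ℕ) (x : ℝ³),
      (1 + ‖x‖) ^ K * ‖iteratedFDeriv ℝ k ((fun j => a (φ j)) n) x‖ ≤ C k K :=
    fun n => (h (φ n)).2.2.2
  have hval : ∀ x, Tendsto (fun j => a (φ j) x) atTop (𝓝 (g x)) := compact_tendsto_apply hlim'
  have hder : ∀ x, Tendsto (fun j => fderiv ℝ (a (φ j)) x) atTop (𝓝 (fderiv ℝ g x)) :=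
    compact_tendsto_fderiv hlim'
  have htab : ∀ (k K : ℕ) (x : ℝ³), (1 + ‖x‖) ^ K * ‖iteratedFDeriv ℝ k g x‖ ≤ C k K :=
    compact_table_limit htb hlim'
  refine ⟨φ, g, hφ, hg, compact_divFree_limit (fun n => (h (φ n)).2.1) hder,
    compact_axisym_limit (fun n => (h (φ n)).2.2.1) hval, htab, ?_⟩
  -- `H¹` convergence by dominated convergence, values and gradients separately
  have h0 : Tendsto (fun n => ∫⁻ x, ‖a (φ n) x - g x‖ₑ ^ 2) atTop (𝓝 0) := by
    refine compact_lintegral_tendsto_zero (c := 2 * C 0 2)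
      (fun n => (h (φ n)).1.continuous.sub hg.continuous) (fun n x => ?_)
      (fun x => tendsto_sub_nhds_zero_iff.2 (hval x))
    have h1 := htb n 0 2 x
    have h2 := htab 0 2 x
    rw [norm_iteratedFDeriv_zero] at h1 h2
    exact compact_weighted_sub_le (by positivity) h1 h2
  have h1 : Tendsto (fun n => ∫⁻ x, ‖fderiv ℝ (a (φ n)) x - fderiv ℝ g x‖ₑ ^ 2) atTop (𝓝 0) := by
    refine compact_lintegral_tendsto_zero (c := 2 * C 1 2)
      (fun n => ((h (φ n)).1.continuous_fderiv (by simp)).sub (hg.continuous_fderiv (by simp)))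
      (fun n x => ?_) (fun x => tendsto_sub_nhds_zero_iff.2 (hder x))
    have h1 := htb n 1 2 x
    have h2 := htab 1 2 x
    rw [norm_iteratedFDeriv_one] at h1 h2
    exact compact_weighted_sub_le (by positivity) h1 h2
  have hsum := h0.add h1
  rw [add_zero] at hsum
  intro ε hε
  obtain ⟨N, hN⟩ := ENNReal.tendsto_atTop_zero.1 hsum (ENNReal.ofReal ε) (ENNReal.ofReal_pos.2 hε)
  exact ⟨N, fun n hn => hN n hn⟩

end Summit.NavierStokesRegularity.NavierStokesRegularity.Theorems.CertifiedBlowupAxisymBlowup.CompactAmplification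

end
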